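import Summits.Parity.GeneralizedHardyLittlewood.Theorems.LeeYangFibresAbsoluteUpgradeUniformDefs
import Mathlib.Analysis.SpecialFunctions.Pow.Asymptotics
import HarnessLib

/-!
# Route `LeeYangFibres`, crux `AbsoluteUpgrade` (stmt-Parity-14116), line `Sketch` (uniform amplification):
# growth bookkeeping uniform in the number of translates

The stubs of the reshaped line `Cruxes/AbsoluteUpgrade/Lines/Sketch.lean` (vocabulary
`Theorems/LeeYangFibresAbsoluteUpgradeUniformDefs.lean`) are quantified over all numbers of translates
`m` with `(m+1) t ≤ (log log N)^A` AFTER the scale `N`.  Every "junk" factor met in their proofs —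
`b^{m+1}`, `(log N)^{T}`, `T^j`, `(C (log log N)^{t-1})^{m+1}`, `y_N^{T}` — has logarithm
`O((log log N)^{A+1}) = o(log N)`, hence is eventually `≤ N^δ` for every `δ > 0`, UNIFORMLY in the
admissible `m`.  This file proves that bookkeeping once (`eventually_mul_loglog_pow_le` and its
corollaries) together with the lower bound `c (log log N)^A ≤ y_N = truncLevel N` eventually.

References: B. Green, T. Tao, Ann. of Math. 171 (2010), Lemma 1.3 [GreenTao2010]; P. X. Gallagher,
Mathematika 23 (1976), §2 [Gallagher1976].
-/

noncomputable section

open scoped BigOperators Topology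
open Filter Asymptotics
open Summit.Parity.GeneralizedHardyLittlewood.Cruxes.RelativeDimOne.TranslateAmplification (truncLevel)

namespace Summit.Parity.GeneralizedHardyLittlewood.Cruxes.AbsoluteUpgrade.UniformAmplification

/-! ### `log log N → ∞` and `(log log N)^k = o(log N)` -/

/-- `log log N` is eventually above any constant (along the natural numbers; the landed
`tendsto` forms live in unrelated modules, so the eventual form is what this file exports). [folklore] -/
theorem eventually_le_loglog (c : ℝ) : ∀ᶠ N : ℕ in atTop, c ≤ Real.log (Real.log N) :=
  (Real.tendsto_log_atTop.comp (Real.tendsto_log_atTop.comp tendsto_natCast_atTop_atTop)).eventually_ge_atTop c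

/-- `0 < log N` eventually (along the natural numbers). [folklore] -/
theorem eventually_log_pos : ∀ᶠ N : ℕ in atTop, 0 < Real.log N :=
  (Real.tendsto_log_atTop.comp tendsto_natCast_atTop_atTop).eventually_gt_atTop 0

/-- `(log log N)^k = o(log N)`. [folklore] -/
theorem isLittleO_loglog_pow_log (k : ℕ) :
    (fun N : ℕ => Real.log (Real.log N) ^ k) =o[atTop] fun N : ℕ => Real.log N := by
  have h := (Real.isLittleO_pow_log_id_atTop (n := k)).comp_tendsto
    (Real.tendsto_log_atTop.comp tendsto_natCast_atTop_atTop)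
  exact h.congr (fun _ => rfl) (fun _ => rfl)

/-- **Master bound.** For every `k`, `c` and `δ > 0`: `c (log log N)^k ≤ δ log N` for all large `N`.
[folklore] -/
theorem eventually_mul_loglog_pow_le (k : ℕ) (c : ℝ) {δ : ℝ} (hδ : 0 < δ) :
    ∀ᶠ N : ℕ in atTop, c * Real.log (Real.log N) ^ k ≤ δ * Real.log N := by
  rcases le_or_gt c 0 with hc | hc
  · filter_upwards [eventually_le_loglog 0,
      tendsto_natCast_atTop_atTop.eventually_ge_atTop (1 : ℝ)] with N h1 h2
    have h3 : 0 ≤ Real.log N := Real.log_nonneg h2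
    have h4 : c * Real.log (Real.log N) ^ k ≤ 0 :=
      mul_nonpos_of_nonpos_of_nonneg hc (pow_nonneg h1 k)
    nlinarith
  · have h := (isLittleO_loglog_pow_log k).def (show 0 < δ / c from div_pos hδ hc)
    filter_upwards [h, eventually_le_loglog 0,
      tendsto_natCast_atTop_atTop.eventually_ge_atTop (1 : ℝ)] with N hN h1 h2
    rw [Real.norm_of_nonneg (pow_nonneg h1 k), Real.norm_of_nonneg (Real.log_nonneg h2)] at hN
    calc c * Real.log (Real.log N) ^ k ≤ c * (δ / c * Real.log N) :=
          mul_le_mul_of_nonneg_left hN hc.le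
      _ = δ * Real.log N := by field_simp

/-- **Master bound, registered sub-goal form** (uncurried `eventually_mul_loglog_pow_le`; this is the
statement the toolkit is filed under on the crux item). [folklore] -/
theorem uniformGrowth_master : ∀ (k : ℕ) (c δ : ℝ), 0 < δ → ∀ᶠ N : ℕ in atTop, c * Real.log (Real.log N) ^ k ≤ δ * Real.log N :=
  fun k c _δ hδ => eventually_mul_loglog_pow_le k c hδ

/-- Exponential form of the master bound: `exp(c (log log N)^k) ≤ N^δ` for all large `N`. [folklore] -/
theorem eventually_exp_mul_loglog_pow_le_rpow (k : ℕ) (c : ℝ) {δ : ℝ} (hδ : 0 < δ) :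
    ∀ᶠ N : ℕ in atTop, Real.exp (c * Real.log (Real.log N) ^ k) ≤ (N : ℝ) ^ δ := by
  filter_upwards [eventually_mul_loglog_pow_le k c hδ, eventually_gt_atTop 0] with N hN hN0
  have hN0' : (0 : ℝ) < N := by exact_mod_cast hN0
  rw [Real.rpow_def_of_pos hN0']
  exact Real.exp_le_exp.mpr (by linarith)

/-- Uniform exponential form: for all large `N`, EVERY real `x ≤ c (log log N)^k` has `exp x ≤ N^δ`.
[folklore] -/
theorem eventually_forall_exp_le_rpow (k : ℕ) (c : ℝ) {δ : ℝ} (hδ : 0 < δ) :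
    ∀ᶠ N : ℕ in atTop, ∀ x : ℝ, x ≤ c * Real.log (Real.log N) ^ k → Real.exp x ≤ (N : ℝ) ^ δ := by
  filter_upwards [eventually_exp_mul_loglog_pow_le_rpow k c hδ] with N hN x hx
  exact (Real.exp_le_exp.mpr hx).trans hN

/-! ### Junk factors of admissible size are `≤ N^δ`, uniformly -/

/-- `b^n ≤ N^δ` for all `n ≤ c (log log N)^A` (`b ≥ 1`), for all large `N`. [folklore] -/
theorem eventually_pow_le_rpow (A : ℕ) {b : ℝ} (hb : 1 ≤ b) (c : ℝ) {δ : ℝ} (hδ : 0 < δ) :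
    ∀ᶠ N : ℕ in atTop, ∀ n : ℕ, (n : ℝ) ≤ c * Real.log (Real.log N) ^ A → b ^ n ≤ (N : ℝ) ^ δ := by
  filter_upwards [eventually_forall_exp_le_rpow A (c * Real.log b) hδ] with N hN n hn
  have hb0 : 0 < b := by linarith
  have hlogb : 0 ≤ Real.log b := Real.log_nonneg hb
  calc b ^ n = Real.exp (n * Real.log b) := by
        rw [← Real.log_pow, Real.exp_log (pow_pos hb0 n)]
    _ ≤ (N : ℝ) ^ δ := hN _ (by
        calc (n : ℝ) * Real.log b ≤ c * Real.log (Real.log N) ^ A * Real.log b :=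
              mul_le_mul_of_nonneg_right hn hlogb
          _ = c * Real.log b * Real.log (Real.log N) ^ A := by ring)

/-- `(log N)^n ≤ N^δ` for all `n ≤ c (log log N)^A`, for all large `N`. [folklore] -/
theorem eventually_log_pow_le_rpow (A : ℕ) (c : ℝ) {δ : ℝ} (hδ : 0 < δ) :
    ∀ᶠ N : ℕ in atTop, ∀ n : ℕ, (n : ℝ) ≤ c * Real.log (Real.log N) ^ A →
      Real.log N ^ n ≤ (N : ℝ) ^ δ := by
  filter_upwards [eventually_forall_exp_le_rpow (A + 1) c hδ, eventually_le_loglog 0,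
    eventually_log_pos] with N hN hll hlog n hn
  calc Real.log N ^ n = Real.exp (n * Real.log (Real.log N)) := by
        rw [← Real.log_pow, Real.exp_log (pow_pos hlog n)]
    _ ≤ (N : ℝ) ^ δ := hN _ (by
        calc (n : ℝ) * Real.log (Real.log N) ≤ c * Real.log (Real.log N) ^ A * Real.log (Real.log N) :=
              mul_le_mul_of_nonneg_right hn hll
          _ = c * Real.log (Real.log N) ^ (A + 1) := by ring)

/-- `(log log N)^n ≤ N^δ` for all `n ≤ c (log log N)^A`, for all large `N`. [folklore] -/
theorem eventually_loglog_pow_le_rpow (A : ℕ) (c : ℝ) {δ : ℝ} (hδ : 0 < δ) :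
    ∀ᶠ N : ℕ in atTop, ∀ n : ℕ, (n : ℝ) ≤ c * Real.log (Real.log N) ^ A →
      Real.log (Real.log N) ^ n ≤ (N : ℝ) ^ δ := by
  filter_upwards [eventually_log_pow_le_rpow A c hδ, eventually_le_loglog 0, eventually_log_pos]
    with N hN hll hlog n hn
  have hle : Real.log (Real.log N) ≤ Real.log N := Real.log_le_self hlog.le
  exact (pow_le_pow_left₀ hll hle n).trans (hN n hn)

/-- `n^j ≤ N^δ` for all `n ≤ c (log log N)^A` (`j` fixed), for all large `N`. [folklore] -/
theorem eventually_natCast_pow_le_rpow (A j : ℕ) (c : ℝ) {δ : ℝ} (hδ : 0 < δ) :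
    ∀ᶠ N : ℕ in atTop, ∀ n : ℕ, (n : ℝ) ≤ c * Real.log (Real.log N) ^ A →
      (n : ℝ) ^ j ≤ (N : ℝ) ^ δ := by
  filter_upwards [eventually_forall_exp_le_rpow A (j * c) hδ] with N hN n hn
  have h1 : (n : ℝ) ^ j ≤ Real.exp (j * n) := by
    calc (n : ℝ) ^ j ≤ Real.exp n ^ j :=
          pow_le_pow_left₀ (Nat.cast_nonneg n) (by linarith [Real.add_one_le_exp (n : ℝ)]) j
      _ = Real.exp (j * n) := by rw [← Real.exp_nat_mul]
  refine h1.trans (hN _ ?_)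
  calc (j : ℝ) * n ≤ j * (c * Real.log (Real.log N) ^ A) :=
        mul_le_mul_of_nonneg_left hn (Nat.cast_nonneg j)
    _ = j * c * Real.log (Real.log N) ^ A := by ring

/-- `(C (log log N)^j)^n ≤ N^δ` for all `n ≤ c (log log N)^A` (`C ≥ 0`, `j` fixed), for all large `N`
(the shape of the singular-product mass bound `𝔖 ≤ C (log log N)^{t-1}` raised to the power `m + 1`).
[folklore] -/
theorem eventually_mul_loglog_pow_pow_le_rpow (A j : ℕ) {C : ℝ} (hC : 0 ≤ C) (c : ℝ) {δ : ℝ}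
    (hδ : 0 < δ) :
    ∀ᶠ N : ℕ in atTop, ∀ n : ℕ, (n : ℝ) ≤ c * Real.log (Real.log N) ^ A →
      (C * Real.log (Real.log N) ^ j) ^ n ≤ (N : ℝ) ^ δ := by
  have hδ2 : 0 < δ / 2 := by positivity
  filter_upwards [eventually_pow_le_rpow A (show (1 : ℝ) ≤ C + 1 by linarith) c hδ2,
    eventually_loglog_pow_le_rpow A (j * |c|) hδ2, eventually_le_loglog 0,
    eventually_gt_atTop 0] with N h1 h2 hll hN0 n hn
  have hN0' : (0 : ℝ) < N := by exact_mod_cast hN0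
  have hjn : ((j * n : ℕ) : ℝ) ≤ j * |c| * Real.log (Real.log N) ^ A := by
    push_cast
    have : (n : ℝ) ≤ |c| * Real.log (Real.log N) ^ A :=
      hn.trans (mul_le_mul_of_nonneg_right (le_abs_self c) (pow_nonneg hll A))
    calc (j : ℝ) * n ≤ j * (|c| * Real.log (Real.log N) ^ A) :=
          mul_le_mul_of_nonneg_left this (Nat.cast_nonneg j)
      _ = j * |c| * Real.log (Real.log N) ^ A := by ring
  calc (C * Real.log (Real.log N) ^ j) ^ n = C ^ n * Real.log (Real.log N) ^ (j * n) := by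
        rw [mul_pow, ← pow_mul]
    _ ≤ (C + 1) ^ n * Real.log (Real.log N) ^ (j * n) := by gcongr; linarith
    _ ≤ (N : ℝ) ^ (δ / 2) * (N : ℝ) ^ (δ / 2) :=
        mul_le_mul (h1 n hn) (h2 (j * n) hjn) (pow_nonneg hll _) (Real.rpow_nonneg hN0'.le _)
    _ = (N : ℝ) ^ δ := by rw [← Real.rpow_add hN0']; ring_nf

/-! ### The truncation level `y_N = ⌊log N / 4⌋` dominates every power of `log log N` -/

/-- `y_N ≤ log N` for `N ≥ 1`. [folklore] -/
theorem truncLevel_le_log {N : ℕ} (hN : 1 ≤ N) : (truncLevel N : ℝ) ≤ Real.log N := by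
  have h1 : (truncLevel N : ℝ) ≤ Real.log N / 4 := by
    unfold truncLevel
    exact Nat.floor_le (div_nonneg (Real.log_nonneg (by exact_mod_cast hN)) (by norm_num))
  have h2 : 0 ≤ Real.log N := Real.log_nonneg (by exact_mod_cast hN)
  linarith

/-- `log N / 4 - 1 ≤ y_N`. [folklore] -/
theorem log_div_four_sub_one_le_truncLevel (N : ℕ) : Real.log N / 4 - 1 ≤ (truncLevel N : ℝ) := by
  unfold truncLevel
  have := Nat.lt_floor_add_one (Real.log N / 4)
  linarith

/-- `c (log log N)^A ≤ y_N` for all large `N`. [folklore] -/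
theorem eventually_mul_loglog_pow_le_truncLevel (A : ℕ) (c : ℝ) :
    ∀ᶠ N : ℕ in atTop, c * Real.log (Real.log N) ^ A ≤ (truncLevel N : ℝ) := by
  filter_upwards [eventually_mul_loglog_pow_le A (|c| + 1) (show (0 : ℝ) < 1 / 4 by norm_num),
    eventually_le_loglog 1] with N hN hll
  have h1 : 1 ≤ Real.log (Real.log N) ^ A := one_le_pow₀ hll
  have h2 : c * Real.log (Real.log N) ^ A ≤ |c| * Real.log (Real.log N) ^ A :=
    mul_le_mul_of_nonneg_right (le_abs_self c) (by positivity)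
  have h3 := log_div_four_sub_one_le_truncLevel N
  nlinarith

/-- The typical admissibility consequence: if `(m+1) t ≤ (log log N)^A` then, for all large `N`,
`c ((m+1) t)^j ≤ y_N` (e.g. `y_N ≥ 2T`, `y_N ≥ T²/η`, `y_N ≥ T⁴/η²` with `T = (m+1)t`). [folklore] -/
theorem eventually_mul_pow_le_truncLevel (A j : ℕ) (c : ℝ) :
    ∀ᶠ N : ℕ in atTop, ∀ T : ℕ, (T : ℝ) ≤ Real.log (Real.log N) ^ A →
      c * (T : ℝ) ^ j ≤ (truncLevel N : ℝ) := by
  filter_upwards [eventually_mul_loglog_pow_le_truncLevel (A * j) |c|, eventually_le_loglog 0]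
    with N hN hll T hT
  have h1 : (T : ℝ) ^ j ≤ (Real.log (Real.log N) ^ A) ^ j := pow_le_pow_left₀ (Nat.cast_nonneg T) hT j
  rw [← pow_mul] at h1
  calc c * (T : ℝ) ^ j ≤ |c| * (T : ℝ) ^ j := mul_le_mul_of_nonneg_right (le_abs_self c) (by positivity)
    _ ≤ |c| * Real.log (Real.log N) ^ (A * j) := mul_le_mul_of_nonneg_left h1 (abs_nonneg c)
    _ ≤ (truncLevel N : ℝ) := hN

end Summit.Parity.GeneralizedHardyLittlewood.Cruxes.AbsoluteUpgrade.UniformAmplification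

end
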